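import Literature.NumberTheory.GaloisRepresentations.ArtinRestriction
import Literature.NumberTheory.EllipticCurves.DivisionFieldRamificationProofs
import Literature.NumberTheory.GaloisRepresentations.IntegralGaloisActionProofs
import Literature.NumberTheory.EllipticCurves.H1TrivialAction
import HarnessLib

/-!
# Crux `PrintCFram.BottomClassIndexLawFiveLe` (stmt-BirchSwinnertonDyer-20372), line `eisenstein-resource-bdp-line` (v11):
# Stub H′, Road A step A3(i) — THE ABELIAN EXTENSION CUT OUT BY A CHARACTER `φ : Γ_F → ℤ/p`, and its ramification read
# from the inertia groups `φ` kills

Cell `bsd-print-cfram`, width seat `bsd-line-cfram-p1-w4` (generation g5), `--supports stmt-BirchSwinnertonDyer-20372` (helper).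
THEOREMS ONLY (generic Galois / ramification plumbing over a number field `F`); no definition, no named fact, no `sorry`.
BSD is not proved by any of this; no summit statement is proved by this seat; no stub is closed.

WHY. After `HerbrandSelmerToHom.stubH_of_forall_hom_field` (p652573) the v11 stub `stub_homVanishing_of_bernoulliPair` is the
statement, over the number field `L = K''(θ)`, that every continuous character `φ : Γ_L → ℤ/p`, `θ`-equivariant along `res`,
killing the inertia groups `I_𝔔 ≤ Γ_L` above the places over `v ∉ S` (`v ∤ p`) and the decomposition groups `D_𝔔` above `𝔭`,
is trivial. Road A (LEAD g8 report §4) continues: (A3) such a `φ` cuts out a cyclic extension `E_φ/L` of degree `p`, unramified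
where `φ` kills inertia, so that the conductor theorem places `E_φ` inside a ray class field `L^𝔪` with `𝔪` supported above `𝔭̄`
(`ConductorOfAbelianExtension.le_narrowRayClassField_iff_conductor_dvd`, `isUnramifiedIn_iff_not_conductor_dvd`). This file is
A3(i), the passage from the character to the field, in the currency those class-field files speak
(`E : IntermediateField F (AlgebraicClosure F)`, `[FiniteDimensional F E]`, `[IsAbelianGalois F E]`, `Algebra.IsUnramifiedIn (𝓞 E) v.asIdeal`):

* `isOpen_setOf_apply_eq_zero`, `mul_inv_conj_apply_eq_zero` — the zero set of a continuous additive `φ` is open; `φ` kills commutators.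
* **`exists_characterField`** — for `φ : Γ_F → ℤ/p` continuous and additive there are an open normal subgroup `N ≤ Γ_F` with
  `g ∈ N ↔ φ g = 0` and `E = F̄^N ⊆ F̄` with `E.fixingSubgroup = N`, `E/F` FINITE ABELIAN (`FiniteDimensional`, `IsAbelianGalois`), a
  FAITHFUL character `χ : Gal(E/F) →* Multiplicative (ℤ/p)` with `χ(σ|_E) = φ(σ)`, and: **for every finite place `v` of `F` at
  which `φ` kills the inertia group of every prime of `\bar ℤ_F` above `v`, `v` is UNRAMIFIED in `E`** (`Algebra.IsUnramifiedIn (𝓞 E) v`;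
  tree `ramificationIdx_eq_one_of_inertia_le_fixingSubgroup` + Mathlib `isUnramifiedIn_iff_forall_ramificationIdx_eq_one`), and
  for every `v` at which `φ` kills the decomposition groups above `v`, those decomposition groups fix `E` pointwise (the input of
  «`v` splits completely in `E`» / `Frob_v = 1` for the Artin map).
* `isUnramifiedIn_of_forall_inertia_apply_eq_zero` — the ramification clause alone, for any finite Galois `E ⊆ F̄` whose fixing
  group contains the zero set of `φ`.

Road A next (not here): A3(ii) `E ≤ L^𝔪` for `𝔪 = conductor E` supported on the primes where `φ` does NOT kill inertia (after
w7's S-erasure: above `𝔭̄` only), `χ` ∘ Artin as a character of `Cl_L^𝔪` killing the classes of the primes above `𝔭` (split), A4–A6.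

References: Neukirch, *Algebraic Number Theory* I §9 (9.6), IV §1, VI §6 (6.6); Milne, *Fields and Galois Theory* §7 (Krull);
the LEAD g8 report §4 (crux workfile).
-/

noncomputable section

-- summit-side namespace `Summit.BirchSwinnertonDyer.BirchSwinnertonDyer.…` (single-conjunct summit, D-0017 layout)
set_option linter.dupNamespace false
set_option autoImplicit false

open scoped Classical Pointwise
open NumberField IsDedekindDomain Field IntermediateField
open Literature.NumberTheory.EllipticCurves
open Literature.NumberTheory.GaloisRepresentations

namespace Summit.BirchSwinnertonDyer.BirchSwinnertonDyer.Theorems.PrintCFram.HerbrandCharacterField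

variable {F : Type} [Field F] [NumberField F] {p : ℕ} [hp : Fact p.Prime]

/-! ## §1 Continuous additive characters `Γ_F → ℤ/p` -/

omit [NumberField F] in
/-- The zero set of a continuous map to the discrete group `ℤ/p` is open. [folklore] -/
theorem isOpen_setOf_apply_eq_zero (φ : absoluteGaloisGroup F → ZMod p) (hφ : Continuous φ) :
    IsOpen {g : absoluteGaloisGroup F | φ g = 0} :=
  isOpen_ker_of_continuous hφ

omit [NumberField F] in
/-- An additive `φ` kills every `(στ)⁻¹(τσ)`: its kernel contains the commutators. [folklore] -/
theorem mul_inv_conj_apply_eq_zero (φ : absoluteGaloisGroup F → ZMod p)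
    (hadd : ∀ a b : absoluteGaloisGroup F, φ (a * b) = φ a + φ b) (σ τ : absoluteGaloisGroup F) :
    φ ((σ * τ)⁻¹ * (τ * σ)) = 0 := by
  rw [hadd, map_inv_eq_neg_of_map_mul' hadd, hadd, hadd]
  abel

omit [NumberField F] in
/-- The multiplicative avatar `g ↦ ofAdd (φ g)` of an additive `φ` is a group homomorphism whose kernel is the zero set of `φ`.
[folklore] -/
theorem mem_ker_mk'_iff (φ : absoluteGaloisGroup F → ZMod p)
    (hadd : ∀ a b : absoluteGaloisGroup F, φ (a * b) = φ a + φ b) (g : absoluteGaloisGroup F) :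
    g ∈ (MonoidHom.mk' (fun g : absoluteGaloisGroup F ↦ Multiplicative.ofAdd (φ g))
        (fun a b ↦ by rw [hadd, ofAdd_add])).ker ↔ φ g = 0 := by
  rw [MonoidHom.mem_ker, MonoidHom.mk'_apply]
  exact ⟨fun h ↦ Multiplicative.ofAdd.injective (h.trans ofAdd_zero.symm), fun h ↦ by rw [h, ofAdd_zero]⟩

/-! ## §2 Ramification of a finite Galois `E ⊆ F̄` from the inertia groups `φ` kills -/

/-- **Unramified where `φ` kills inertia.** Let `E ⊆ F̄` be finite Galois over `F` with `Gal(F̄/E) ⊇ {φ = 0}`. If `φ` kills the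
inertia group `I_𝔓 ≤ Γ_F` of every prime `𝔓` of `\bar ℤ_F` above the finite place `v`, then `v` is unramified in `E`: every `I_𝔓`
fixes `E`, so every prime of `𝓞 E` over `v` has ramification index `1` (tree `ramificationIdx_eq_one_of_inertia_le_fixingSubgroup`,
Neukirch I (9.6)), which is unramifiedness over a number ring (Mathlib `isUnramifiedIn_iff_forall_ramificationIdx_eq_one`).
[cite: NeukirchANT1999, Ch. I §9 Prop. (9.6)] -/
theorem isUnramifiedIn_of_forall_inertia_apply_eq_zero (φ : absoluteGaloisGroup F → ZMod p)
    (E : IntermediateField F (AlgebraicClosure F)) [FiniteDimensional F E] [IsGalois F E]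
    (hE : ∀ g : absoluteGaloisGroup F, φ g = 0 → g ∈ E.fixingSubgroup) (v : HeightOneSpectrum (𝓞 F))
    (hv : ∀ 𝔓 ∈ v.primesAbove, ∀ τ ∈ 𝔓.inertia (absoluteGaloisGroup F), φ τ = 0) :
    Algebra.IsUnramifiedIn (𝓞 E) v.asIdeal := by
  obtain ⟨𝔓, h𝔓⟩ := HeightOneSpectrum.primesAbove_nonempty v
  haveI := h𝔓.1
  haveI := h𝔓.2
  have hI : 𝔓.inertia (AlgebraicClosure F ≃ₐ[F] AlgebraicClosure F) ≤ E.fixingSubgroup :=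
    fun τ hτ ↦ hE τ (hv 𝔓 h𝔓 τ hτ)
  haveI : NumberField E := { to_charZero := inferInstance, to_finiteDimensional := Module.Finite.trans F E }
  intro Q hQ hlo
  exact Ideal.ramificationIdx_eq_one_iff.mp
    (@ramificationIdx_eq_one_of_inertia_le_fixingSubgroup F _ _ E _ _ v 𝔓 h𝔓.1 h𝔓.2 hI Q hQ hlo)

omit [NumberField F] in
/-- **Decomposition groups killed by `φ` fix `E` pointwise** (the Galois form of «`v` splits completely in `E`»: every Frobenius at
every prime above `v` restricts to the identity of `E`). [cite: NeukirchANT1999, Ch. I §9 Prop. (9.6)] -/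
theorem decompositionSubgroup_le_fixingSubgroup_of_forall_apply_eq_zero (φ : absoluteGaloisGroup F → ZMod p)
    (E : IntermediateField F (AlgebraicClosure F)) (hE : ∀ g : absoluteGaloisGroup F, φ g = 0 → g ∈ E.fixingSubgroup)
    (v : HeightOneSpectrum (𝓞 F))
    (hv : ∀ 𝔓 ∈ v.primesAbove, ∀ τ ∈ 𝔓.decompositionSubgroup (absoluteGaloisGroup F), φ τ = 0)
    {𝔓 : Ideal (absIntegers (𝓞 F) F)} (h𝔓 : 𝔓 ∈ v.primesAbove) :
    𝔓.decompositionSubgroup (absoluteGaloisGroup F) ≤ E.fixingSubgroup :=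
  fun τ hτ ↦ hE τ (hv 𝔓 h𝔓 τ hτ)

/-! ## §3 The extension cut out by `φ` -/

/-- **The abelian extension cut out by a continuous character `φ : Γ_F → ℤ/p`.** There are an OPEN NORMAL subgroup `N ≤ Γ_F` with
`g ∈ N ↔ φ g = 0` and a subfield `E = F̄^N ⊆ F̄` with `E.fixingSubgroup = N`, FINITE and ABELIAN over `F`, together with a FAITHFUL
character `χ : Gal(E/F) →* Multiplicative (ℤ/p)` with `χ(σ|_E) = φ(σ)` for all `σ ∈ Γ_F`; moreover `v` is UNRAMIFIED in `E` whenever `φ`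
kills the inertia groups of the primes of `\bar ℤ_F` above `v`, and the decomposition groups above `v` fix `E` whenever `φ` kills them.
This is step A3(i) of Road A: the conductor theorem (`ConductorOfAbelianExtension`) and `narrowRayClassField_galEquivRayClassGroup`
apply to `E`. [cite: NeukirchANT1999, Ch. IV §1] [cite: NeukirchANT1999, Ch. I §9 Prop. (9.6)] [cite: NeukirchANT1999, Ch. VI §6 Cor. (6.6)] -/
theorem exists_characterField (φ : absoluteGaloisGroup F → ZMod p) (hφ : Continuous φ)
    (hadd : ∀ a b : absoluteGaloisGroup F, φ (a * b) = φ a + φ b) :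
    ∃ (N : Subgroup (absoluteGaloisGroup F)) (E : IntermediateField F (AlgebraicClosure F)),
      (∀ g : absoluteGaloisGroup F, g ∈ N ↔ φ g = 0) ∧ N.Normal ∧ IsOpen (N : Set (absoluteGaloisGroup F)) ∧
      E.fixingSubgroup = N ∧ FiniteDimensional F E ∧ IsAbelianGalois F E ∧
      (∃ χ : (E ≃ₐ[F] E) →* Multiplicative (ZMod p), Function.Injective χ ∧
        ∀ (σ : absoluteGaloisGroup F) (a : E ≃ₐ[F] E), (∀ x : E, ((a x : E) : AlgebraicClosure F) = σ • (x : AlgebraicClosure F)) →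
          χ a = Multiplicative.ofAdd (φ σ)) ∧
      (∀ v : HeightOneSpectrum (𝓞 F), (∀ 𝔓 ∈ v.primesAbove, ∀ τ ∈ 𝔓.inertia (absoluteGaloisGroup F), φ τ = 0) →
        Algebra.IsUnramifiedIn (𝓞 E) v.asIdeal) ∧
      (∀ v : HeightOneSpectrum (𝓞 F), (∀ 𝔓 ∈ v.primesAbove, ∀ τ ∈ 𝔓.decompositionSubgroup (absoluteGaloisGroup F), φ τ = 0) →
        ∀ 𝔓 ∈ v.primesAbove, 𝔓.decompositionSubgroup (absoluteGaloisGroup F) ≤ E.fixingSubgroup) := by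
  -- the multiplicative avatar of `φ` and its kernel
  let φm : absoluteGaloisGroup F →* Multiplicative (ZMod p) :=
    MonoidHom.mk' (fun g ↦ Multiplicative.ofAdd (φ g)) (fun a b ↦ by rw [hadd, ofAdd_add])
  have hφm : ∀ g, φm g = Multiplicative.ofAdd (φ g) := fun g ↦ rfl
  let N : Subgroup (absoluteGaloisGroup F) := φm.ker
  have hN : ∀ g, g ∈ N ↔ φ g = 0 := fun g ↦ mem_ker_mk'_iff φ hadd g
  haveI hNn : N.Normal := MonoidHom.normal_ker φm
  have hNo : IsOpen (N : Set (absoluteGaloisGroup F)) := by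
    have e : (N : Set (absoluteGaloisGroup F)) = {g | φ g = 0} := Set.ext fun g ↦ hN g
    rw [e]
    exact isOpen_setOf_apply_eq_zero φ hφ
  -- the fixed field
  let E : IntermediateField F (AlgebraicClosure F) := fixedField N
  have hE : E.fixingSubgroup = N := fixingSubgroup_fixedField_of_isOpen N hNo
  haveI hfd : FiniteDimensional F E := finiteDimensional_fixedField_of_isOpen N hNo
  haveI : IsGalois F (AlgebraicClosure F) := {}
  haveI hGal : IsGalois F E := IsGalois.of_fixedField_normal_subgroup (hn := hNn) N
  haveI : Normal F E := hGal.to_normal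
  -- the faithful character of `Gal(E/F)`
  have hsurj : Function.Surjective (AlgEquiv.restrictNormalHom E : absoluteGaloisGroup F →* (E ≃ₐ[F] E)) :=
    AlgEquiv.restrictNormalHom_surjective (F := F) (K₁ := E) (AlgebraicClosure F)
  have hker : (AlgEquiv.restrictNormalHom E : absoluteGaloisGroup F →* (E ≃ₐ[F] E)).ker = N := by
    rw [IntermediateField.restrictNormalHom_ker, hE]
  have hkerle : (AlgEquiv.restrictNormalHom E : absoluteGaloisGroup F →* (E ≃ₐ[F] E)).ker ≤ φm.ker := le_of_eq hker
  let χ : (E ≃ₐ[F] E) →* Multiplicative (ZMod p) :=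
    MonoidHom.liftOfSurjective _ hsurj ⟨φm, hkerle⟩
  have hχ : ∀ σ : absoluteGaloisGroup F, χ (AlgEquiv.restrictNormalHom E σ) = Multiplicative.ofAdd (φ σ) := fun σ ↦ by
    rw [← hφm]
    exact MonoidHom.liftOfRightInverse_comp_apply _ _ (Function.rightInverse_surjInv hsurj) ⟨φm, hkerle⟩ σ
  have hχinj : Function.Injective χ := by
    rw [← MonoidHom.ker_eq_bot_iff, eq_bot_iff]
    intro a ha
    obtain ⟨σ, rfl⟩ := hsurj a
    rw [MonoidHom.mem_ker, hχ] at ha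
    have hσ : σ ∈ N := (hN σ).2 (Multiplicative.ofAdd.injective (ha.trans ofAdd_zero.symm))
    rw [← hker] at hσ
    exact (MonoidHom.mem_ker.1 hσ).symm ▸ Subgroup.one_mem _
  -- commutativity of `Gal(E/F)`: commutators of lifts lie in `ker φ = N = Gal(F̄/E)`
  haveI hcomm : IsMulCommutative (E ≃ₐ[F] E) := by
    refine ⟨⟨fun a b ↦ ?_⟩⟩
    obtain ⟨σ, rfl⟩ := hsurj a
    obtain ⟨τ, rfl⟩ := hsurj b
    rw [← map_mul, ← map_mul, eq_comm, ← inv_mul_eq_one, ← map_inv, ← map_mul, ← MonoidHom.mem_ker, hker]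
    exact (hN _).2 (mul_inv_conj_apply_eq_zero φ hadd τ σ)
  haveI hab : IsAbelianGalois F E := IsAbelianGalois.mk
  have hχ' : ∀ (σ : absoluteGaloisGroup F) (a : E ≃ₐ[F] E), (∀ x : E, ((a x : E) : AlgebraicClosure F) = σ • (x : AlgebraicClosure F)) →
      χ a = Multiplicative.ofAdd (φ σ) := by
    intro σ a ha
    have hres : ∀ x : E, (((AlgEquiv.restrictNormalHom E σ : E ≃ₐ[F] E) x : E) : AlgebraicClosure F) =
        σ • (x : AlgebraicClosure F) := fun x ↦
      AlgEquiv.restrictNormal_commutes σ E x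
    have e : a = AlgEquiv.restrictNormalHom E σ :=
      AlgEquiv.ext fun x ↦ Subtype.ext ((ha x).trans (hres x).symm)
    rw [e, hχ]
  have hmem : ∀ g : absoluteGaloisGroup F, φ g = 0 → g ∈ E.fixingSubgroup := fun g hg ↦ by rw [hE]; exact (hN g).2 hg
  exact ⟨N, E, hN, hNn, hNo, hE, hfd, hab, ⟨χ, hχinj, hχ'⟩,
    fun v hv ↦ isUnramifiedIn_of_forall_inertia_apply_eq_zero φ E hmem v hv,
    fun v hv 𝔓 h𝔓 ↦ decompositionSubgroup_le_fixingSubgroup_of_forall_apply_eq_zero φ E hmem v hv h𝔓⟩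

end Summit.BirchSwinnertonDyer.BirchSwinnertonDyer.Theorems.PrintCFram.HerbrandCharacterField

end
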